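import Summits.AtomisticToContinuum.Crystallization.Theorems.UniformPolytypeStability.Negative.Mirror

/-!
# `UniformPolytypeStability` (stmt-AtomisticToContinuum-15800), negative side II: single-site rows on Bravais site sets

Part II of the standing disprover's load-bearing analysis of crux `UniformPolytypeStability`
(route `DisclinationRation`).  For a layered set `L(a,s,z)` that is (as a set) a rank-3 discrete
`ℤ`-submodule `L` (part I, `sites_const_zU`: the fcc word at uniform heights), the crux's double
`tsum`s are reindexed by `L` (`tsum_tsum_sites_eq`) and the second variation of the single-site
displacement `ξ·𝟙_{0}` (`uS ξ`) is computed exactly: `hessForm = 2·Σ'_{y ∈ L, y ≠ 0} ξᵀK(y)ξ`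
(`hessForm_single`; the origin row is the full row sum, every other row `x` is the single term
`ξᵀK(x)ξ` by evenness of `K`, and the row function is absolutely summable by
`|ξᵀK(y)ξ| ≤ 904‖y‖⁻⁸`).  This is the common skeleton of the dilation witness (part III) and of
any other single-site witness on the fcc/hcp sub-family.  All `[folklore]`.
-/

noncomputable section

namespace Summit.AtomisticToContinuum.Crystallization.Theorems.UniformPolytypeStabilityNegative

open scoped BigOperators Topology Classical InnerProductSpace
open Filter Set Function
open Literature.MathematicalPhysics.StatisticalMechanics
open Summit.AtomisticToContinuum.Crystallization.Theorems.PhononStabilityNegative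

local notation "E3" => EuclideanSpace ℝ (Fin 3)

/-! ## §4 Single-site displacements on Bravais site sets: the row structure of the second variation -/

/-- The single-site displacement `ξ·𝟙_{0}`. [folklore] -/
def uS (ξ : E3) : E3 → E3 := fun p => if p = 0 then ξ else 0

/-- `u 0 = ξ`. [folklore] -/
@[simp] theorem uS_zero (ξ : E3) : uS ξ 0 = ξ := if_pos rfl

/-- `u p = 0` off the origin. [folklore] -/
theorem uS_of_ne (ξ : E3) {p : E3} (hp : p ≠ 0) : uS ξ p = 0 := if_neg hp

/-- `u` is supported in `{0}`. [folklore] -/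
theorem support_uS (ξ : E3) : Function.support (uS ξ) ⊆ {0} := by
  intro p hp; by_contra h; exact hp (if_neg h)

/-- `u` is finitely supported. [folklore] -/
theorem finite_support_uS (ξ : E3) : (Function.support (uS ξ)).Finite :=
  (Set.finite_singleton (0 : E3)).subset (support_uS ξ)

section Rows

variable {a : ℝ} {s : ℤ → ℤ} {z : ℤ → ℝ}

/-- Sites are lattice vectors (set equality read pointwise, no dependent rewriting). [folklore] -/
theorem mem_of_sites_eq (L : Submodule ℤ E3) (hS : Sites a s z = (L : Set E3)) {x : E3}
    (hx : x ∈ Sites a s z) : x ∈ L := by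
  rw [hS] at hx; exact hx

/-- Lattice vectors are sites. [folklore] -/
theorem mem_sites_of_eq (L : Submodule ℤ E3) (hS : Sites a s z = (L : Set E3)) {x : E3}
    (hx : x ∈ L) : x ∈ Sites a s z := by
  rw [hS]; exact hx

/-- The site with lattice label `x`. [folklore] -/
def ι (L : Submodule ℤ E3) (hS : Sites a s z = (L : Set E3)) (x : L) : Sites a s z :=
  ⟨x, mem_sites_of_eq L hS x.2⟩

/-- Labels determine sites. [folklore] -/
theorem ι_injective (L : Submodule ℤ E3) (hS : Sites a s z = (L : Set E3)) :
    Function.Injective (ι L hS) := fun _ _ h =>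
  Subtype.ext (congrArg (fun p : Sites a s z => (p : E3)) h)

/-- Every site has a label. [folklore] -/
theorem range_ι (L : Submodule ℤ E3) (hS : Sites a s z = (L : Set E3)) :
    Set.range (ι L hS) = Set.univ := by
  refine Set.eq_univ_of_forall fun p => ?_
  exact ⟨⟨p, mem_of_sites_eq L hS p.2⟩, Subtype.ext rfl⟩

/-- Reindexing a site sum by lattice labels. [folklore] -/
theorem tsum_sites_eq (L : Submodule ℤ E3) (hS : Sites a s z = (L : Set E3)) (F : E3 → ℝ) :
    ∑' p : Sites a s z, F p = ∑' x : L, F x := by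
  have hr : Function.support (fun p : Sites a s z => F p) ⊆ Set.range (ι L hS) := by
    rw [range_ι]; exact Set.subset_univ _
  rw [← (ι_injective L hS).tsum_eq hr]
  rfl

/-- Reindexing a double site sum by lattice labels. [folklore] -/
theorem tsum_tsum_sites_eq (L : Submodule ℤ E3) (hS : Sites a s z = (L : Set E3))
    (F : E3 → E3 → ℝ) :
    ∑' p : Sites a s z, ∑' q : Sites a s z, F p q = ∑' x : L, ∑' y : L, F x y := by
  rw [tsum_sites_eq L hS (fun p => ∑' q : Sites a s z, F p q)]
  exact tsum_congr fun x => tsum_sites_eq L hS (F x)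

/-- The row function of a single-site displacement: `H(y) = ξᵀK(y)ξ` off the origin. [folklore] -/
def Hrow (L : Submodule ℤ E3) (ξ : E3) (y : L) : ℝ := if y = 0 then 0 else Hess₀ (y : E3) ξ

/-- On a lattice with no nonzero vector shorter than `1/2` the row function is absolutely summable
(`|ξᵀK(y)ξ| ≤ 904‖y‖⁻⁸`, Mathlib `ZLattice.summable_norm_sub_inv_pow`). [folklore] -/
theorem summable_Hrow (L : Submodule ℤ E3) [DiscreteTopology L] (hL : Module.finrank ℤ L = 3)
    (hmin : ∀ y ∈ L, y ≠ 0 → (1 / 2 : ℝ) ≤ ‖y‖) {ξ : E3} (hξ : ‖ξ‖ = 1) :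
    Summable (Hrow L ξ) := by
  have h8 := ZLattice.summable_norm_sub_inv_pow L 8 (by rw [hL]; norm_num) 0
  simp only [sub_zero] at h8
  refine Summable.of_norm_bounded (h8.mul_left 904) fun y => ?_
  rw [Real.norm_eq_abs]
  unfold Hrow
  split_ifs with hy
  · rw [abs_zero]; positivity
  · have hy' : (y : E3) ≠ 0 := fun h => hy (Submodule.coe_eq_zero.1 h)
    exact abs_Hess₀_le_inv_pow (hmin y y.2 hy') hξ

/-- **Row structure of the second variation of `ξ·𝟙_{0}` on a Bravais site set:** the origin row
is `Σ' H`, the row of a site `x ≠ 0` is the single term `H(x)` (evenness of `K` in both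
arguments), so `hessForm = 2·Σ'_y H(y)`. [folklore] -/
theorem hessForm_single (L : Submodule ℤ E3) [DiscreteTopology L] (hL : Module.finrank ℤ L = 3)
    (hS : Sites a s z = (L : Set E3)) (hmin : ∀ y ∈ L, y ≠ 0 → (1 / 2 : ℝ) ≤ ‖y‖)
    {ξ : E3} (hξ : ‖ξ‖ = 1) :
    hessForm a s z (uS ξ) = 2 * ∑' y : L, Hrow L ξ y := by
  unfold hessForm
  rw [tsum_tsum_sites_eq L hS (fun p q => if p ≠ q then Hess₀ (p - q) (uS ξ p - uS ξ q) else 0)]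
  have hrow : ∀ x : L, (∑' y : L, if (x : E3) ≠ y then Hess₀ ((x : E3) - y) (uS ξ x - uS ξ y) else 0) =
      Hrow L ξ x + if x = 0 then ∑' y, Hrow L ξ y else 0 := by
    intro x
    by_cases hx : x = 0
    · subst hx
      rw [if_pos rfl]
      have h0 : Hrow L ξ 0 = 0 := by simp [Hrow]
      rw [h0, zero_add]
      refine tsum_congr fun y => ?_
      by_cases hy : y = 0
      · subst hy; simp [Hrow]
      · have hy' : (y : E3) ≠ 0 := fun h => hy (Submodule.coe_eq_zero.1 h)
        rw [Submodule.coe_zero, if_pos hy'.symm, uS_zero, uS_of_ne ξ hy', sub_zero, zero_sub,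
          Hess₀_neg_left]
        simp [Hrow, hy]
    · rw [if_neg hx, add_zero]
      have hx' : (x : E3) ≠ 0 := fun h => hx (Submodule.coe_eq_zero.1 h)
      have hfun : (fun y : L => if (x : E3) ≠ y then Hess₀ ((x : E3) - y) (uS ξ x - uS ξ y) else 0) =
          fun y => if y = 0 then Hrow L ξ x else 0 := by
        funext y
        by_cases hy : y = 0
        · subst hy
          rw [if_pos rfl, Submodule.coe_zero, if_pos hx', uS_of_ne ξ hx', uS_zero, sub_zero, zero_sub,
            Hess₀_neg_right]
          simp [Hrow, hx]
        · have hy' : (y : E3) ≠ 0 := fun h => hy (Submodule.coe_eq_zero.1 h)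
          by_cases hxy : (x : E3) = y
          · rw [if_neg (not_not.2 hxy), if_neg hy]
          · rw [if_pos hxy, if_neg hy, uS_of_ne ξ hx', uS_of_ne ξ hy', sub_zero, Hess₀_zero_right]
      rw [hfun, tsum_ite_eq]
  rw [show (fun x : L => ∑' y : L, if (x : E3) ≠ y then Hess₀ ((x : E3) - y) (uS ξ x - uS ξ y) else 0) =
      fun x => Hrow L ξ x + if x = 0 then ∑' y, Hrow L ξ y else 0 from funext hrow]
  rw [(summable_Hrow L hL hmin hξ).tsum_add (hasSum_ite_eq (0 : L) _).summable, tsum_ite_eq]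
  ring

end Rows

end Summit.AtomisticToContinuum.Crystallization.Theorems.UniformPolytypeStabilityNegative

end
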